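import Summits.AtomisticToContinuum.Crystallization.Theorems.ChargedEnergyGapPhiEnvelope
import HarnessLib

/-!
# ChargedEnergyGap · NODE 95 «TiltEnvelope» — certified brackets for the six tilted-domino weights `tiltSext ϱ ρ d` over a census cell
`(ρ, d) ∈ [ρ₀, ρ₁] × [d₀, d₁]`, and the signed-price lower bound of the cap row

decomp-a2c lens-3 g90 (L3 kernel, cap side; memo CELLLP-SPEC-g90 §7 / critic row 1606 (A-c); imports NODE 94 «PhiEnvelope» (to land first:
`depthProfile_monotone`, the endpoint lemmas, `EnvBelow`/`EnvAbove`) and through it tree-only …FeetLawA (`tiltSext`, `depthProfile`) + …MemberValues.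

The cap of (D¹) contains `roofVal T75 (tiltSext ϱ ρ d)`, minorised (NODE 93, weak duality) by `Σ_p y_p · tiltSext ϱ ρ d p` for a dual-feasible price vector `y`
of MIXED signs.  Over a census cell the checker needs a certified constant (this node) or affine-in-`d` (grid refinement, §95.3) lower bound of that sum.
The six weights are `φ(d − ρ)` (poles) and `φ(√q_c(ρ, d))`, `q_c(ρ,d) = (d−ρ)² + 2ρ² + 2(d−ρ)ρ·c`, `c ∈ {439/485, 527/485, 483/485}` (tree `tiltSext`,
§95.1 `tiltSext_eq`).  Since `φ` is monotone, brackets on the ARGUMENTS give brackets on the weights (§95.2: `q_c` is increasing in `d` on `d ≥ ρ ≥ 0` and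
CONVEX in `ρ` for `c ≤ 3/2`, so over the cell `q_c ≤ max of the two corners at d = d₁` and `q_c ≥ the tangent line at (ρ₀, d₀) minimised over [ρ₀, ρ₁]`;
square-root brackets `r² ≤ q ≤ r'²` are pushed through `φ` by §95.1) — every hypothesis is a polynomial inequality in rationals, `norm_num`-checkable.
§95.3: the signed assembly `Σ_p min (y_p L_p) (y_p U_p) ≤ Σ_p y_p W_p` for `W ∈ [L, U]` componentwise, and the grid check with CERTIFIED POINT VALUES
`EnvBelowV` / `EnvAboveV` (pairs `(a_j, v_j)`, `v_j ≤ f a_j` resp. `f a_j ≤ v_j` proved separately — e.g. by the sqrt brackets) for affine-in-`d` rows, sound for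
`f` monotone on `[a₀, ∞)`.  §95.4: the affine-in-`d` refinement — one-variable brackets `tiltArgLo ≤ q_c(ρ,·) ≤ tiltArgHi` uniform in `ρ ∈ [ρ₀, ρ₁]`, both
increasing in `d` on `[ρ₁, ∞)`, so `φ(√tiltArgLo)` / `φ(√tiltArgHi)` are monotone minorant / majorant weights to which the grid checks apply.

[SUPPORT node: inequalities + five bookkeeping defs (`tiltArg`, `tiltArgLo`, `tiltArgHi`, `EnvBelowV`, `EnvAboveV`), all PROVED, 0 sorry; no cone statement touched; consumer: L5 slab files.] -/

noncomputable section
open scoped Classical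
open Literature.MathematicalPhysics.StatisticalMechanics Literature.Geometry.DiscreteGeometry
open Summit.AtomisticToContinuum.Crystallization.Theses.PricedLinkCensus
open Summit.AtomisticToContinuum.Crystallization.Theorems.ChargedEnergyGapNegative

namespace Summit.AtomisticToContinuum.Crystallization.Theorems.ChargedEnergyGapChartDial

/-! ## §95.1 The tilt arguments and square-root brackets through `φ` -/
section TiltArgs

/-- ★ The quadratic under the square root of the equatorial tilted-domino depths: `q_c(ρ,d) = (d−ρ)² + 2ρ² + 2(d−ρ)ρ·c`. -/
def tiltArg (c ρ d : ℝ) : ℝ := (d - ρ) ^ 2 + 2 * ρ ^ 2 + 2 * (d - ρ) * ρ * c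

/-- [formal bookkeeping] `tiltSext` through `tiltArg` (definitional). -/
theorem tiltSext_eq (ϱ ρ d : ℝ) : tiltSext ϱ ρ d =
    sext (depthProfile ϱ (d - ρ)) (depthProfile ϱ (d - ρ))
      (depthProfile ϱ (Real.sqrt (tiltArg (439 / 485) ρ d))) (depthProfile ϱ (Real.sqrt (tiltArg (527 / 485) ρ d)))
      (depthProfile ϱ (Real.sqrt (tiltArg (483 / 485) ρ d))) (depthProfile ϱ (Real.sqrt (tiltArg (483 / 485) ρ d))) := rfl

/-- [formal bookkeeping] the six components. -/
theorem tiltSext_apply (ϱ ρ d : ℝ) :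
    tiltSext ϱ ρ d (0, true) = depthProfile ϱ (d - ρ) ∧ tiltSext ϱ ρ d (0, false) = depthProfile ϱ (d - ρ) ∧
    tiltSext ϱ ρ d (1, true) = depthProfile ϱ (Real.sqrt (tiltArg (439 / 485) ρ d)) ∧
    tiltSext ϱ ρ d (1, false) = depthProfile ϱ (Real.sqrt (tiltArg (527 / 485) ρ d)) ∧
    tiltSext ϱ ρ d (2, true) = depthProfile ϱ (Real.sqrt (tiltArg (483 / 485) ρ d)) ∧
    tiltSext ϱ ρ d (2, false) = depthProfile ϱ (Real.sqrt (tiltArg (483 / 485) ρ d)) := by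
  simp [tiltSext_eq, sext]

/-- ★ Lower sqrt bracket through `φ`: `0 ≤ r`, `r² ≤ q` ⇒ `φ(r) ≤ φ(√q)`. -/
theorem depthProfile_sqrt_ge {ϱ : ℝ} (hϱ : 0 < ϱ) {q r : ℝ} (hr : 0 ≤ r) (hq : r ^ 2 ≤ q) :
    depthProfile ϱ r ≤ depthProfile ϱ (Real.sqrt q) := by
  refine depthProfile_monotone hϱ ?_
  calc r = Real.sqrt (r ^ 2) := (Real.sqrt_sq hr).symm
    _ ≤ Real.sqrt q := Real.sqrt_le_sqrt hq

/-- ★ Upper sqrt bracket through `φ`: `0 ≤ r`, `q ≤ r²` ⇒ `φ(√q) ≤ φ(r)`. -/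
theorem depthProfile_sqrt_le {ϱ : ℝ} (hϱ : 0 < ϱ) {q r : ℝ} (hr : 0 ≤ r) (hq : q ≤ r ^ 2) :
    depthProfile ϱ (Real.sqrt q) ≤ depthProfile ϱ r := by
  refine depthProfile_monotone hϱ ?_
  calc Real.sqrt q ≤ Real.sqrt (r ^ 2) := Real.sqrt_le_sqrt hq
    _ = r := Real.sqrt_sq hr

end TiltArgs

/-! ## §95.2 `q_c` over a cell: increasing in `d`, convex in `ρ` -/
section Quad

/-- ★ `q_c` is increasing in `d` on `d ≥ ρ ≥ 0` (`c ≥ 0`). -/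
theorem tiltArg_mono_d {c ρ d d' : ℝ} (hc : 0 ≤ c) (hρ : 0 ≤ ρ) (hρd : ρ ≤ d) (hdd : d ≤ d') : tiltArg c ρ d ≤ tiltArg c ρ d' := by
  unfold tiltArg
  nlinarith [mul_nonneg (sub_nonneg.2 hdd) (sub_nonneg.2 hρd), mul_nonneg (sub_nonneg.2 hdd) hρ, mul_nonneg (mul_nonneg (sub_nonneg.2 hdd) hρ) hc]

/-- ★ Tangent minorant in `ρ` (convexity, `c ≤ 3/2`): `q_c(ρ,d) ≥ q_c(ρ₀,d) + ∂_ρ q_c(ρ₀,d)·(ρ − ρ₀)`, `∂_ρ q_c(ρ₀,d) = d(2c−2) + 2ρ₀(3−2c)`. -/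
theorem tiltArg_tangent_le {c : ℝ} (hc : c ≤ 3 / 2) (ρ₀ ρ d : ℝ) :
    tiltArg c ρ₀ d + (d * (2 * c - 2) + 2 * ρ₀ * (3 - 2 * c)) * (ρ - ρ₀) ≤ tiltArg c ρ d := by
  unfold tiltArg
  nlinarith [mul_nonneg (by linarith : (0:ℝ) ≤ 3 - 2 * c) (sq_nonneg (ρ - ρ₀))]

/-- ★ Convexity in `ρ` (`c ≤ 3/2`): on `[ρ₀, ρ₁]`, `q_c(ρ,d) ≤ max (q_c(ρ₀,d)) (q_c(ρ₁,d))`. -/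
theorem tiltArg_le_max_endpoints {c : ℝ} (hc : c ≤ 3 / 2) {ρ₀ ρ ρ₁ : ℝ} (h₀ : ρ₀ ≤ ρ) (h₁ : ρ ≤ ρ₁) (d : ℝ) :
    tiltArg c ρ d ≤ max (tiltArg c ρ₀ d) (tiltArg c ρ₁ d) := by
  have e₀ : tiltArg c ρ d - tiltArg c ρ₀ d = (ρ - ρ₀) * (d * (2 * c - 2) + (ρ + ρ₀) * (3 - 2 * c)) := by unfold tiltArg; ring
  have e₁ : tiltArg c ρ d - tiltArg c ρ₁ d = (ρ - ρ₁) * (d * (2 * c - 2) + (ρ + ρ₁) * (3 - 2 * c)) := by unfold tiltArg; ring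
  by_cases hB : d * (2 * c - 2) + (ρ + ρ₀) * (3 - 2 * c) ≤ 0
  · refine le_max_of_le_left ?_
    nlinarith [mul_nonpos_iff.2 (Or.inl ⟨sub_nonneg.2 h₀, hB⟩)]
  · refine le_max_of_le_right ?_
    have hB₁ : 0 ≤ d * (2 * c - 2) + (ρ + ρ₁) * (3 - 2 * c) := by
      nlinarith [mul_nonneg (by linarith : (0:ℝ) ≤ ρ₁ - ρ₀) (by linarith : (0:ℝ) ≤ 3 - 2 * c)]
    nlinarith [mul_nonpos_iff.2 (Or.inr ⟨sub_nonpos.2 h₁, hB₁⟩)]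

/-- ★★ **LOWER ARGUMENT BRACKET over a cell (PROVED)**: for `(ρ, d) ∈ [ρ₀, ρ₁] × [d₀, d₁]` with `0 ≤ ρ₀`, `ρ₁ ≤ d₀`, `0 ≤ c ≤ 3/2`, a rational `qlo` below
the tangent line at `(ρ₀, d₀)` at BOTH ends of `[ρ₀, ρ₁]` is below `q_c` on the whole cell. -/
theorem tiltArg_ge_box {c ρ₀ ρ₁ d₀ qlo : ℝ} (hc : 0 ≤ c) (hc' : c ≤ 3 / 2) (hρ₀ : 0 ≤ ρ₀) (hρd : ρ₁ ≤ d₀)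
    (h₀ : qlo ≤ tiltArg c ρ₀ d₀) (h₁ : qlo ≤ tiltArg c ρ₀ d₀ + (d₀ * (2 * c - 2) + 2 * ρ₀ * (3 - 2 * c)) * (ρ₁ - ρ₀))
    {ρ d : ℝ} (hρ : ρ₀ ≤ ρ) (hρ' : ρ ≤ ρ₁) (hd : d₀ ≤ d) : qlo ≤ tiltArg c ρ d := by
  have hmono := tiltArg_mono_d hc (hρ₀.trans hρ) (hρ'.trans hρd) hd
  have htan := tiltArg_tangent_le hc' ρ₀ ρ d₀
  have haff := min_endpoints_le_of_mem (d₀ * (2 * c - 2) + 2 * ρ₀ * (3 - 2 * c)) (tiltArg c ρ₀ d₀) ρ₀ ρ₁ ρ hρ hρ'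
  have hmin : qlo ≤ min ((d₀ * (2 * c - 2) + 2 * ρ₀ * (3 - 2 * c)) * (ρ₀ - ρ₀) + tiltArg c ρ₀ d₀)
      ((d₀ * (2 * c - 2) + 2 * ρ₀ * (3 - 2 * c)) * (ρ₁ - ρ₀) + tiltArg c ρ₀ d₀) := le_min (by simpa using h₀) (by linarith)
  linarith
where
  /-- an affine function of `ρ ∈ [ρ₀, ρ₁]` is at least the smaller endpoint value -/
  min_endpoints_le_of_mem (s c ρ₀ ρ₁ ρ : ℝ) (h₀ : ρ₀ ≤ ρ) (h₁ : ρ ≤ ρ₁) :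
      min (s * (ρ₀ - ρ₀) + c) (s * (ρ₁ - ρ₀) + c) ≤ s * (ρ - ρ₀) + c := by
    rcases le_total 0 s with hs | hs
    · exact min_le_of_left_le (by nlinarith)
    · exact min_le_of_right_le (by nlinarith)

/-- ★★ **UPPER ARGUMENT BRACKET over a cell (PROVED)**: `q_c ≤ qhi` on the cell as soon as `qhi` dominates the two corners at `d = d₁`. -/
theorem tiltArg_le_box {c ρ₀ ρ₁ d₁ qhi : ℝ} (hc : 0 ≤ c) (hc' : c ≤ 3 / 2) (hρ₀ : 0 ≤ ρ₀)
    (h₀ : tiltArg c ρ₀ d₁ ≤ qhi) (h₁ : tiltArg c ρ₁ d₁ ≤ qhi)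
    {ρ d : ℝ} (hρ : ρ₀ ≤ ρ) (hρ' : ρ ≤ ρ₁) (hρd' : ρ ≤ d) (hd : d ≤ d₁) : tiltArg c ρ d ≤ qhi := by
  have hmono := tiltArg_mono_d hc (hρ₀.trans hρ) hρd' hd
  have hmax := tiltArg_le_max_endpoints hc' hρ hρ' d₁
  exact hmono.trans (hmax.trans (max_le h₀ h₁))

/-- ★★ **WEIGHT BRACKETS over a cell (PROVED)**: equatorial component `φ(√q_c) ∈ [φ(r), φ(r')]` from `r² ≤ qlo`, `qhi ≤ r'²`. -/
theorem depthProfile_tilt_mem_box {ϱ : ℝ} (hϱ : 0 < ϱ) {c ρ₀ ρ₁ d₀ d₁ qlo qhi r r' : ℝ} (hc : 0 ≤ c) (hc' : c ≤ 3 / 2) (hρ₀ : 0 ≤ ρ₀)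
    (hρd : ρ₁ ≤ d₀)
    (hlo₀ : qlo ≤ tiltArg c ρ₀ d₀) (hlo₁ : qlo ≤ tiltArg c ρ₀ d₀ + (d₀ * (2 * c - 2) + 2 * ρ₀ * (3 - 2 * c)) * (ρ₁ - ρ₀))
    (hhi₀ : tiltArg c ρ₀ d₁ ≤ qhi) (hhi₁ : tiltArg c ρ₁ d₁ ≤ qhi) (hr : 0 ≤ r) (hrq : r ^ 2 ≤ qlo) (hr' : 0 ≤ r') (hrq' : qhi ≤ r' ^ 2)
    {ρ d : ℝ} (hρ : ρ₀ ≤ ρ) (hρ' : ρ ≤ ρ₁) (hd : d₀ ≤ d) (hd' : d ≤ d₁) :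
    depthProfile ϱ r ≤ depthProfile ϱ (Real.sqrt (tiltArg c ρ d)) ∧ depthProfile ϱ (Real.sqrt (tiltArg c ρ d)) ≤ depthProfile ϱ r' :=
  ⟨depthProfile_sqrt_ge hϱ hr (hrq.trans (tiltArg_ge_box hc hc' hρ₀ hρd hlo₀ hlo₁ hρ hρ' hd)),
   depthProfile_sqrt_le hϱ hr' ((tiltArg_le_box hc hc' hρ₀ hhi₀ hhi₁ hρ hρ' ((hρ'.trans hρd).trans hd) hd').trans hrq')⟩

/-- ★ Pole component `φ(d − ρ) ∈ [φ(d₀ − ρ₁), φ(d₁ − ρ₀)]` over the cell. -/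
theorem depthProfile_pole_mem_box {ϱ : ℝ} (hϱ : 0 < ϱ) {ρ₀ ρ₁ d₀ d₁ ρ d : ℝ} (hρ : ρ₀ ≤ ρ) (hρ' : ρ ≤ ρ₁) (hd : d₀ ≤ d) (hd' : d ≤ d₁) :
    depthProfile ϱ (d₀ - ρ₁) ≤ depthProfile ϱ (d - ρ) ∧ depthProfile ϱ (d - ρ) ≤ depthProfile ϱ (d₁ - ρ₀) :=
  ⟨depthProfile_monotone hϱ (by linarith), depthProfile_monotone hϱ (by linarith)⟩

end Quad

/-! ## §95.3 Signed assembly of the cap row, and grids with certified point values -/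
section Assembly

/-- ★★ **SIGNED BRACKET SUM (PROVED)**: if `L ≤ W ≤ U` componentwise then `Σ_p min (y_p L_p) (y_p U_p) ≤ Σ_p y_p W_p` for prices `y` of ANY signs
(the census takes `L_p` where `y_p ≥ 0` and `U_p` where `y_p < 0`). -/
theorem sum_min_mul_le_sum_mul {ι : Type*} (S : Finset ι) (y L U W : ι → ℝ) (hL : ∀ p ∈ S, L p ≤ W p) (hU : ∀ p ∈ S, W p ≤ U p) :
    ∑ p ∈ S, min (y p * L p) (y p * U p) ≤ ∑ p ∈ S, y p * W p := by
  refine Finset.sum_le_sum fun p hp => ?_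
  rcases le_total 0 (y p) with hy | hy
  · exact min_le_of_left_le (mul_le_mul_of_nonneg_left (hL p hp) hy)
  · exact min_le_of_right_le (mul_le_mul_of_nonpos_left (hU p hp) hy)

/-- ★ The cap-row constant minorant over a cell: componentwise brackets of `tiltSext` ⇒ `Σ_p min (y_p L_p) (y_p U_p) ≤ Σ_p y_p · tiltSext ϱ ρ d p`. -/
theorem tiltRow_ge_of_brackets (ϱ ρ d : ℝ) (y L U : Fin 3 × Bool → ℝ) (hL : ∀ p, L p ≤ tiltSext ϱ ρ d p) (hU : ∀ p, tiltSext ϱ ρ d p ≤ U p) :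
    ∑ p, min (y p * L p) (y p * U p) ≤ ∑ p, y p * tiltSext ϱ ρ d p :=
  sum_min_mul_le_sum_mul Finset.univ y L U (tiltSext ϱ ρ d) (fun p _ => hL p) (fun p _ => hU p)

/-- ★★ Grid check for an affine MINORANT with CERTIFIED POINT VALUES: pairs `(a_j, v_j)`; conditions `a_j ≤ a_{j+1}` and `max (ℓ a_j) (ℓ a_{j+1}) − δ ≤ v_j`. -/
def EnvBelowV (s c δ : ℝ) : List (ℝ × ℝ) → Prop
  | [] => True
  | [av] => s * av.1 + c - δ ≤ av.2
  | av :: bv :: l => (av.1 ≤ bv.1 ∧ max (s * av.1 + c) (s * bv.1 + c) - δ ≤ av.2) ∧ EnvBelowV s c δ (bv :: l)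

/-- ★★ Grid check for an affine MAJORANT with certified point values: `v_{j+1}` majorises on `[a_j, a_{j+1}]`: `v_{j+1} ≤ min (ℓ a_j) (ℓ a_{j+1}) + δ`. -/
def EnvAboveV (s c δ : ℝ) : List (ℝ × ℝ) → Prop
  | [] => True
  | [av] => av.2 ≤ s * av.1 + c + δ
  | av :: bv :: l => (av.1 ≤ bv.1 ∧ bv.2 ≤ min (s * av.1 + c) (s * bv.1 + c) + δ) ∧ EnvAboveV s c δ (bv :: l)

/-- ★★★ **SOUNDNESS (PROVED)**: `f` monotone on `[a₀, ∞)`, certified values `v_j ≤ f a_j`, grid check ⇒ `s·d + c − δ ≤ f d` on `[a₀, a_last]`. -/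
theorem envBelowV_sound {f : ℝ → ℝ} {s c δ : ℝ} :
    ∀ (l : List (ℝ × ℝ)) (av : ℝ × ℝ), MonotoneOn f (Set.Ici av.1) → (∀ bv ∈ av :: l, bv.2 ≤ f bv.1) → EnvBelowV s c δ (av :: l) →
      ∀ d, av.1 ≤ d → d ≤ ((av :: l).getLast (List.cons_ne_nil av l)).1 → s * d + c - δ ≤ f d
  | [], av, _, hv, h, d, had, hdl => by
      simp only [List.getLast_singleton] at hdl
      have hda : d = av.1 := le_antisymm hdl had
      subst hda
      have h' : s * av.1 + c - δ ≤ av.2 := by simpa [EnvBelowV] using h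
      exact h'.trans (hv av (by simp))
  | bv :: l, av, hf, hv, h, d, had, hdl => by
      simp only [EnvBelowV] at h
      obtain ⟨⟨hab, hfa⟩, hrest⟩ := h
      rcases le_total d bv.1 with hdb | hbd
      · calc s * d + c - δ ≤ max (s * av.1 + c) (s * bv.1 + c) - δ := by linarith [affine_le_max_endpoints s c av.1 bv.1 d had hdb]
          _ ≤ av.2 := hfa
          _ ≤ f av.1 := hv av (by simp)
          _ ≤ f d := hf (Set.mem_Ici.2 le_rfl) (Set.mem_Ici.2 had) had
      · rw [List.getLast_cons_cons] at hdl
        exact envBelowV_sound l bv (hf.mono (Set.Ici_subset_Ici.2 hab)) (fun x hx => hv x (List.mem_cons_of_mem _ hx)) hrest d hbd hdl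

/-- ★★★ **SOUNDNESS (PROVED)**: `f` monotone on `[a₀, ∞)`, certified values `f a_j ≤ v_j`, grid check ⇒ `f d ≤ s·d + c + δ` on `[a₀, a_last]`. -/
theorem envAboveV_sound {f : ℝ → ℝ} {s c δ : ℝ} :
    ∀ (l : List (ℝ × ℝ)) (av : ℝ × ℝ), MonotoneOn f (Set.Ici av.1) → (∀ bv ∈ av :: l, f bv.1 ≤ bv.2) → EnvAboveV s c δ (av :: l) →
      ∀ d, av.1 ≤ d → d ≤ ((av :: l).getLast (List.cons_ne_nil av l)).1 → f d ≤ s * d + c + δ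
  | [], av, _, hv, h, d, had, hdl => by
      simp only [List.getLast_singleton] at hdl
      have hda : d = av.1 := le_antisymm hdl had
      subst hda
      have h' : av.2 ≤ s * av.1 + c + δ := by simpa [EnvAboveV] using h
      exact (hv av (by simp)).trans h'
  | bv :: l, av, hf, hv, h, d, had, hdl => by
      simp only [EnvAboveV] at h
      obtain ⟨⟨hab, hfb⟩, hrest⟩ := h
      rcases le_total d bv.1 with hdb | hbd
      · calc f d ≤ f bv.1 := hf (Set.mem_Ici.2 had) (Set.mem_Ici.2 hab) hdb
          _ ≤ bv.2 := hv bv (by simp)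
          _ ≤ min (s * av.1 + c) (s * bv.1 + c) + δ := hfb
          _ ≤ s * d + c + δ := by linarith [min_endpoints_le_affine s c av.1 bv.1 d had hdb]
      · rw [List.getLast_cons_cons] at hdl
        exact envAboveV_sound l bv (hf.mono (Set.Ici_subset_Ici.2 hab)) (fun x hx => hv x (List.mem_cons_of_mem _ hx)) hrest d hbd hdl

end Assembly

/-! ## §95.4 Affine-in-`d` refinement: monotone one-variable brackets of the weights, uniform in `ρ ∈ [ρ₀, ρ₁]` -/
section Refine

/-- ★ Lower argument bracket as a function of `d` (tangent at `ρ₀`, both ends of `[ρ₀, ρ₁]`). -/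
def tiltArgLo (c ρ₀ ρ₁ d : ℝ) : ℝ :=
  min (tiltArg c ρ₀ d) (tiltArg c ρ₀ d + (d * (2 * c - 2) + 2 * ρ₀ * (3 - 2 * c)) * (ρ₁ - ρ₀))

/-- ★ Upper argument bracket as a function of `d` (the larger corner). -/
def tiltArgHi (c ρ₀ ρ₁ d : ℝ) : ℝ := max (tiltArg c ρ₀ d) (tiltArg c ρ₁ d)

/-- ★★ `tiltArgLo ≤ q_c` on `ρ ∈ [ρ₀, ρ₁]` (any `d`; convexity, `c ≤ 3/2`). -/
theorem tiltArgLo_le {c : ℝ} (hc' : c ≤ 3 / 2) {ρ₀ ρ ρ₁ : ℝ} (h₀ : ρ₀ ≤ ρ) (h₁ : ρ ≤ ρ₁) (d : ℝ) : tiltArgLo c ρ₀ ρ₁ d ≤ tiltArg c ρ d := by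
  have htan := tiltArg_tangent_le hc' ρ₀ ρ d
  have haff := tiltArg_ge_box.min_endpoints_le_of_mem (d * (2 * c - 2) + 2 * ρ₀ * (3 - 2 * c)) (tiltArg c ρ₀ d) ρ₀ ρ₁ ρ h₀ h₁
  unfold tiltArgLo
  have e : min (tiltArg c ρ₀ d) (tiltArg c ρ₀ d + (d * (2 * c - 2) + 2 * ρ₀ * (3 - 2 * c)) * (ρ₁ - ρ₀)) =
      min ((d * (2 * c - 2) + 2 * ρ₀ * (3 - 2 * c)) * (ρ₀ - ρ₀) + tiltArg c ρ₀ d)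
        ((d * (2 * c - 2) + 2 * ρ₀ * (3 - 2 * c)) * (ρ₁ - ρ₀) + tiltArg c ρ₀ d) := by
    congr 1 <;> ring
  rw [e]
  linarith

/-- ★★ `q_c ≤ tiltArgHi` on `ρ ∈ [ρ₀, ρ₁]` (any `d`). -/
theorem le_tiltArgHi {c : ℝ} (hc' : c ≤ 3 / 2) {ρ₀ ρ ρ₁ : ℝ} (h₀ : ρ₀ ≤ ρ) (h₁ : ρ ≤ ρ₁) (d : ℝ) : tiltArg c ρ d ≤ tiltArgHi c ρ₀ ρ₁ d :=
  tiltArg_le_max_endpoints hc' h₀ h₁ d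

/-- ★ `tiltArgLo` is increasing in `d` on `[ρ₁, ∞)` (`0 ≤ c`, `0 ≤ ρ₀ ≤ ρ₁`). -/
theorem tiltArgLo_monotoneOn {c ρ₀ ρ₁ : ℝ} (hc : 0 ≤ c) (hρ₀ : 0 ≤ ρ₀) (hρ : ρ₀ ≤ ρ₁) : MonotoneOn (tiltArgLo c ρ₀ ρ₁) (Set.Ici ρ₁) := by
  intro d hd d' hd' hdd
  simp only [Set.mem_Ici] at hd hd'
  have h1 := tiltArg_mono_d hc hρ₀ (hρ.trans hd) hdd
  have h2 : tiltArg c ρ₀ d + (d * (2 * c - 2) + 2 * ρ₀ * (3 - 2 * c)) * (ρ₁ - ρ₀) ≤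
      tiltArg c ρ₀ d' + (d' * (2 * c - 2) + 2 * ρ₀ * (3 - 2 * c)) * (ρ₁ - ρ₀) := by
    have e : (tiltArg c ρ₀ d' + (d' * (2 * c - 2) + 2 * ρ₀ * (3 - 2 * c)) * (ρ₁ - ρ₀)) -
        (tiltArg c ρ₀ d + (d * (2 * c - 2) + 2 * ρ₀ * (3 - 2 * c)) * (ρ₁ - ρ₀)) =
        (d' - d) * ((d' + d - 2 * ρ₀) + 2 * ρ₀ * c + (2 * c - 2) * (ρ₁ - ρ₀)) := by unfold tiltArg; ring
    have hpos : 0 ≤ (d' - d) * ((d' + d - 2 * ρ₀) + 2 * ρ₀ * c + (2 * c - 2) * (ρ₁ - ρ₀)) :=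
      mul_nonneg (sub_nonneg.2 hdd) (by nlinarith [mul_nonneg hρ₀ hc, mul_nonneg hc (sub_nonneg.2 hρ)])
    linarith
  exact min_le_min h1 h2

/-- ★ `tiltArgHi` is increasing in `d` on `[ρ₁, ∞)`. -/
theorem tiltArgHi_monotoneOn {c ρ₀ ρ₁ : ℝ} (hc : 0 ≤ c) (hρ₀ : 0 ≤ ρ₀) (hρ : ρ₀ ≤ ρ₁) : MonotoneOn (tiltArgHi c ρ₀ ρ₁) (Set.Ici ρ₁) := by
  intro d hd d' hd' hdd
  simp only [Set.mem_Ici] at hd hd'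
  exact max_le_max (tiltArg_mono_d hc hρ₀ (hρ.trans hd) hdd) (tiltArg_mono_d hc (hρ₀.trans hρ) hd hdd)

/-- ★★★ **ONE-VARIABLE WEIGHT BRACKETS (PROVED)**: for every `ρ ∈ [ρ₀, ρ₁]`,
`φ(√tiltArgLo(d)) ≤ φ(√q_c(ρ,d)) ≤ φ(√tiltArgHi(d))` — the outer functions are monotone in `d` on `[ρ₁, ∞)` (next lemma), so NODE 94/95 grid checks apply
to them with certified point values from sqrt brackets. -/
theorem depthProfile_tilt_mem {ϱ : ℝ} (hϱ : 0 < ϱ) {c : ℝ} (hc' : c ≤ 3 / 2) {ρ₀ ρ ρ₁ : ℝ} (h₀ : ρ₀ ≤ ρ) (h₁ : ρ ≤ ρ₁) (d : ℝ) :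
    depthProfile ϱ (Real.sqrt (tiltArgLo c ρ₀ ρ₁ d)) ≤ depthProfile ϱ (Real.sqrt (tiltArg c ρ d)) ∧
    depthProfile ϱ (Real.sqrt (tiltArg c ρ d)) ≤ depthProfile ϱ (Real.sqrt (tiltArgHi c ρ₀ ρ₁ d)) :=
  ⟨depthProfile_monotone hϱ (Real.sqrt_le_sqrt (tiltArgLo_le hc' h₀ h₁ d)),
   depthProfile_monotone hϱ (Real.sqrt_le_sqrt (le_tiltArgHi hc' h₀ h₁ d))⟩

/-- ★ Monotonicity in `d` of the two one-variable brackets and of the pole weight. -/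
theorem tiltWeight_monotoneOn {ϱ : ℝ} (hϱ : 0 < ϱ) {c ρ₀ ρ₁ : ℝ} (hc : 0 ≤ c) (hρ₀ : 0 ≤ ρ₀) (hρ : ρ₀ ≤ ρ₁) :
    MonotoneOn (fun d => depthProfile ϱ (Real.sqrt (tiltArgLo c ρ₀ ρ₁ d))) (Set.Ici ρ₁) ∧
    MonotoneOn (fun d => depthProfile ϱ (Real.sqrt (tiltArgHi c ρ₀ ρ₁ d))) (Set.Ici ρ₁) ∧
    ∀ ρ : ℝ, Monotone (fun d => depthProfile ϱ (d - ρ)) :=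
  ⟨fun d hd d' hd' hdd => depthProfile_monotone hϱ (Real.sqrt_le_sqrt (tiltArgLo_monotoneOn hc hρ₀ hρ hd hd' hdd)),
   fun d hd d' hd' hdd => depthProfile_monotone hϱ (Real.sqrt_le_sqrt (tiltArgHi_monotoneOn hc hρ₀ hρ hd hd' hdd)),
   fun ρ d d' hdd => depthProfile_monotone hϱ (by linarith)⟩

/-- ★ Certified point values through sqrt brackets (the `v_j` of `EnvBelowV` / `EnvAboveV`): `r² ≤ tiltArgLo(a)` ⇒ `φ(r) ≤ φ(√tiltArgLo(a))`, and
`tiltArgHi(a) ≤ r'²` ⇒ `φ(√tiltArgHi(a)) ≤ φ(r')`. -/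
theorem tiltWeight_point_values {ϱ : ℝ} (hϱ : 0 < ϱ) {c ρ₀ ρ₁ a r r' : ℝ} (hr : 0 ≤ r) (hr' : 0 ≤ r') :
    (r ^ 2 ≤ tiltArgLo c ρ₀ ρ₁ a → depthProfile ϱ r ≤ depthProfile ϱ (Real.sqrt (tiltArgLo c ρ₀ ρ₁ a))) ∧
    (tiltArgHi c ρ₀ ρ₁ a ≤ r' ^ 2 → depthProfile ϱ (Real.sqrt (tiltArgHi c ρ₀ ρ₁ a)) ≤ depthProfile ϱ r') :=
  ⟨fun h => depthProfile_sqrt_ge hϱ hr h, fun h => depthProfile_sqrt_le hϱ hr' h⟩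

end Refine

end Summit.AtomisticToContinuum.Crystallization.Theorems.ChargedEnergyGapChartDial

end
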